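import Summits.Ventures.CertifiedArithmetic.Expansions.IncircleExact
import Mathlib.Tactic.Linarith
import Mathlib.Tactic.NormNum

/-!
# ORIENT3D and INCIRCLE, filtered then exact: complete predicates with a correctness proof

NEW WORK of this development (ENGINES group, unit `eng-quad-4`; HONEST FRAMING: shared numerical
engines serving client cells; rigour lives in the verifiers; every published number belongs to a
client cell's ledger, not to the engines group).  Not a published result, hence under
`Summits/Ventures/` with no citation tag of its own.

THE PREDICATES.  `orient3dFiltered` runs Shewchuk's stage-A floating-point filter of ORIENT3D
[Shewchuk1997, §4.4 Fig. 22, Table 3 p. 351 line A; `orient3dStageA` of the Literature file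
`Orient3dStageA.lean`] and returns its value when the filter accepts; otherwise it returns the last
component of the exact expansion `orient3dExact` (`Orient3dExact.lean`).  `incircleFiltered` does
the same with the INCIRCLE filter [Table 5 p. 352 line A; `incircleStageA`] and `incircleExact`
(`IncircleExact.lean`).  This is the paper's adaptive scheme with the intermediate stages B and C
left out — the structure Shewchuk himself uses for INSPHERE, whose stage D "is computed from
scratch" when C is not accurate enough [p. 352] — so it is slower than `predicates.c` on
nearly-degenerate inputs and exactly as fast on the common ones; its interest here is that it is
a COMPLETE predicate (an answer for every input) with an end-to-end theorem.

WHAT IS PROVED.  For `p ≥ 6`, `fl` any round-to-nearest into `F(p, emin)` with `RoundoffBelow 2`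
(e.g. ties-to-even), `tp` a two-product error-free on the operands that occur, and coordinates in
`F(p, e₀)` with `emin ≤ e₀` and `emin + 2p ≤ 3e₀` (ORIENT3D) resp. `emin + 2p ≤ 4e₀` (INCIRCLE) —
the grid conditions of the stage-A theorems, which imply those of the exact routines:
* `orient3dFiltered_correct`, `incircleFiltered_correct` — the returned float `r` satisfies
  `0 < r ↔ 0 < det`, `r < 0 ↔ det < 0` and `r = 0 ↔ det = 0` for the exact determinant
  `orient3dDet` resp. `incircleDet` of the Literature stage-A files: THE SIGN IS ALWAYS RIGHT.
* `orient3dFilteredRNE_correct`, `incircleFilteredRNE_correct` — the IEEE instances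
  (round-to-nearest-even, FMA two-product); binary64: coordinates multiples of `2^−322` (ORIENT3D)
  resp. `2^−242` (INCIRCLE) — i.e. all ordinary data.
The proofs are glue: the stage-A theorems (`orient3dStageA_correct`, `incircleStageA_correct`,
Literature) in the accepting branch, `orient3dExact_sign` / `incircleExact_sign` in the other.

HONEST SCOPE.  (1) Stages B and C are not composed here (their expansions and bounds live in the
`Orient3dStageB*` / `IncircleStageB*` / `*StageCBounds` files); a four-stage composition in the
manner of `orient3dadapt` is future work.  (2) Model conventions as in `Orient2d.lean` and the
exact-routine files (no overflow model; gradual underflow excluded by the grid conditions).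
(3) Nothing is claimed about running times.

Reference for the filters and the adaptive design: J. R. Shewchuk, Discrete Comput. Geom. 18
(1997) 305–363, §4.4 [Shewchuk1997].
-/

namespace Summit.Ventures.CertifiedArithmetic.Expansions

open Literature.ComputerArithmetic.JeannerodRump2018
open Literature.ComputerArithmetic.BoldoJeannerodMelquiondMuller2023 hiding twoSum twoSum_fst
  isFloat_twoSum
open Literature.ComputerArithmetic.Shewchuk1997

variable {p : ℕ} {emin : ℤ} {fl : ℚ → ℚ}

/-- The last component of an expansion (`0` for the empty list, which never occurs below). -/
def lastComponent (l : List ℚ) : ℚ := l.getLast?.getD 0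

/-- On a nonempty list `lastComponent` is `List.getLast`. -/
theorem lastComponent_eq_getLast {l : List ℚ} (h : l ≠ []) : lastComponent l = l.getLast h := by
  unfold lastComponent
  rw [List.getLast?_eq_some_getLast h]
  rfl

/-- Two rationals whose strict signs agree vanish together. -/
private theorem eq_zero_iff_of_sign_iff {r d : ℚ} (h₁ : 0 < r ↔ 0 < d) (h₂ : r < 0 ↔ d < 0) :
    r = 0 ↔ d = 0 := by
  constructor
  · intro hr
    subst hr
    rcases lt_trichotomy d 0 with hd | hd | hd
    · exact absurd (h₂.mpr hd) (lt_irrefl 0)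
    · exact hd
    · exact absurd (h₁.mpr hd) (lt_irrefl 0)
  · intro hd
    subst hd
    rcases lt_trichotomy r 0 with hr | hr | hr
    · exact absurd (h₂.mp hr) (lt_irrefl 0)
    · exact hr
    · exact absurd (h₁.mp hr) (lt_irrefl 0)

/-! ## ORIENT3D -/

/-- ORIENT3D, filtered then exact: the stage-A filter with error-bound constant `K`; if it does
not accept, the last component of the exact expansion. -/
def orient3dFiltered (tp : ℚ → ℚ → ℚ × ℚ) (fl : ℚ → ℚ) (K : ℚ)
    (a₁ a₂ a₃ b₁ b₂ b₃ c₁ c₂ c₃ d₁ d₂ d₃ : ℚ) : ℚ :=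
  match orient3dStageA fl K a₁ a₂ a₃ b₁ b₂ b₃ c₁ c₂ c₃ d₁ d₂ d₃ with
  | some A => A
  | none => lastComponent (orient3dExact tp fl a₁ a₂ a₃ b₁ b₂ b₃ c₁ c₂ c₃ d₁ d₂ d₃)

/-- **ORIENT3D, FILTERED THEN EXACT, IS CORRECT**: with `K = o3derrboundA p = (7 + 56ε)ε`, `p ≥ 6`,
any round-to-nearest `fl` with `RoundoffBelow 2`, an error-free two-product on
`F(p, e₀) × F(p, e₀)` and `F(p, 2e₀) × F(p, e₀)`, and coordinates in `F(p, e₀)` with `emin ≤ e₀`,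
`emin + 2p ≤ 3e₀`, the returned float has exactly the sign of `orient3dDet` (7). -/
theorem orient3dFiltered_correct (hp : 6 ≤ p) (hfl : IsRoundNearest p emin fl)
    (hfl2 : RoundoffBelow 2 fl) {e₀ : ℤ} (he₀ : emin ≤ e₀) (h3 : emin + 2 * p ≤ e₀ + e₀ + e₀)
    {tp : ℚ → ℚ → ℚ × ℚ}
    (htp : ∀ x y, IsFloat p e₀ x → IsFloat p e₀ y → ExactTwoProd p emin fl tp x y)
    (htp' : ∀ x y, IsFloat p (e₀ + e₀) x → IsFloat p e₀ y → ExactTwoProd p emin fl tp x y)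
    {a₁ a₂ a₃ b₁ b₂ b₃ c₁ c₂ c₃ d₁ d₂ d₃ : ℚ}
    (ha₁ : IsFloat p e₀ a₁) (ha₂ : IsFloat p e₀ a₂) (ha₃ : IsFloat p e₀ a₃)
    (hb₁ : IsFloat p e₀ b₁) (hb₂ : IsFloat p e₀ b₂) (hb₃ : IsFloat p e₀ b₃)
    (hc₁ : IsFloat p e₀ c₁) (hc₂ : IsFloat p e₀ c₂) (hc₃ : IsFloat p e₀ c₃)
    (hd₁ : IsFloat p e₀ d₁) (hd₂ : IsFloat p e₀ d₂) (hd₃ : IsFloat p e₀ d₃) :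
    (0 < orient3dFiltered tp fl (o3derrboundA p) a₁ a₂ a₃ b₁ b₂ b₃ c₁ c₂ c₃ d₁ d₂ d₃ ↔
        0 < orient3dDet a₁ a₂ a₃ b₁ b₂ b₃ c₁ c₂ c₃ d₁ d₂ d₃) ∧
      (orient3dFiltered tp fl (o3derrboundA p) a₁ a₂ a₃ b₁ b₂ b₃ c₁ c₂ c₃ d₁ d₂ d₃ < 0 ↔
        orient3dDet a₁ a₂ a₃ b₁ b₂ b₃ c₁ c₂ c₃ d₁ d₂ d₃ < 0) ∧
      (orient3dFiltered tp fl (o3derrboundA p) a₁ a₂ a₃ b₁ b₂ b₃ c₁ c₂ c₃ d₁ d₂ d₃ = 0 ↔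
        orient3dDet a₁ a₂ a₃ b₁ b₂ b₃ c₁ c₂ c₃ d₁ d₂ d₃ = 0) := by
  have key : (0 < orient3dFiltered tp fl (o3derrboundA p) a₁ a₂ a₃ b₁ b₂ b₃ c₁ c₂ c₃ d₁ d₂ d₃ ↔
        0 < orient3dDet a₁ a₂ a₃ b₁ b₂ b₃ c₁ c₂ c₃ d₁ d₂ d₃) ∧
      (orient3dFiltered tp fl (o3derrboundA p) a₁ a₂ a₃ b₁ b₂ b₃ c₁ c₂ c₃ d₁ d₂ d₃ < 0 ↔
        orient3dDet a₁ a₂ a₃ b₁ b₂ b₃ c₁ c₂ c₃ d₁ d₂ d₃ < 0) := by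
    unfold orient3dFiltered
    cases hA : orient3dStageA fl (o3derrboundA p) a₁ a₂ a₃ b₁ b₂ b₃ c₁ c₂ c₃ d₁ d₂ d₃ with
    | some A =>
      exact orient3dStageA_correct hp hfl he₀ h3 ha₁ ha₂ ha₃ hb₁ hb₂ hb₃ hc₁ hc₂ hc₃ hd₁ hd₂ hd₃ hA
    | none =>
      obtain ⟨hD, s₁, s₂, -⟩ := orient3dExact_sign (le_trans (by norm_num) hp) hfl hfl2
        (show emin ≤ e₀ + e₀ by omega) (show emin ≤ e₀ + e₀ + e₀ by omega) htp htp'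
        ha₁ ha₂ ha₃ hb₁ hb₂ hb₃ hc₁ hc₂ hc₃ hd₁ hd₂ hd₃
      simp only [lastComponent_eq_getLast hD]
      exact ⟨s₁.symm, s₂.symm⟩
  exact ⟨key.1, key.2, eq_zero_iff_of_sign_iff key.1 key.2⟩

/-- The IEEE instance: round-to-nearest-even and the FMA two-product. -/
def orient3dFilteredRNE (p : ℕ) (emin : ℤ) (a₁ a₂ a₃ b₁ b₂ b₃ c₁ c₂ c₃ d₁ d₂ d₃ : ℚ) : ℚ :=
  orient3dFiltered (twoProdFMA (roundTiesEven p emin)) (roundTiesEven p emin) (o3derrboundA p)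
    a₁ a₂ a₃ b₁ b₂ b₃ c₁ c₂ c₃ d₁ d₂ d₃

/-- **ORIENT3D, FILTERED THEN EXACT, IS CORRECT ON AN IEEE MACHINE** (`p ≥ 6`, ties-to-even, FMA):
for coordinates in `F(p, e₀)` with `emin ≤ e₀` and `emin + 2p ≤ 3e₀` (binary64: all twelve
coordinates multiples of `2^−322`) the returned float has exactly the sign of `orient3dDet`. -/
theorem orient3dFilteredRNE_correct (hp : 6 ≤ p) {e₀ : ℤ} (he₀ : emin ≤ e₀)
    (h3 : emin + 2 * p ≤ e₀ + e₀ + e₀) {a₁ a₂ a₃ b₁ b₂ b₃ c₁ c₂ c₃ d₁ d₂ d₃ : ℚ}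
    (ha₁ : IsFloat p e₀ a₁) (ha₂ : IsFloat p e₀ a₂) (ha₃ : IsFloat p e₀ a₃)
    (hb₁ : IsFloat p e₀ b₁) (hb₂ : IsFloat p e₀ b₂) (hb₃ : IsFloat p e₀ b₃)
    (hc₁ : IsFloat p e₀ c₁) (hc₂ : IsFloat p e₀ c₂) (hc₃ : IsFloat p e₀ c₃)
    (hd₁ : IsFloat p e₀ d₁) (hd₂ : IsFloat p e₀ d₂) (hd₃ : IsFloat p e₀ d₃) :
    (0 < orient3dFilteredRNE p emin a₁ a₂ a₃ b₁ b₂ b₃ c₁ c₂ c₃ d₁ d₂ d₃ ↔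
        0 < orient3dDet a₁ a₂ a₃ b₁ b₂ b₃ c₁ c₂ c₃ d₁ d₂ d₃) ∧
      (orient3dFilteredRNE p emin a₁ a₂ a₃ b₁ b₂ b₃ c₁ c₂ c₃ d₁ d₂ d₃ < 0 ↔
        orient3dDet a₁ a₂ a₃ b₁ b₂ b₃ c₁ c₂ c₃ d₁ d₂ d₃ < 0) ∧
      (orient3dFilteredRNE p emin a₁ a₂ a₃ b₁ b₂ b₃ c₁ c₂ c₃ d₁ d₂ d₃ = 0 ↔
        orient3dDet a₁ a₂ a₃ b₁ b₂ b₃ c₁ c₂ c₃ d₁ d₂ d₃ = 0) := by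
  have hp1 : 1 ≤ p := le_trans (by norm_num) hp
  have hfl : IsRoundNearest p emin (roundTiesEven p emin) := isRoundNearest_roundTiesEven hp1
  have h2 : emin ≤ e₀ + e₀ := by omega
  exact orient3dFiltered_correct hp hfl (roundoffBelow_two_roundTiesEven p emin) he₀ h3
    (fun x y hx hy => exactTwoProd_twoProdFMA₂ hp1 hfl h2 hx hy)
    (fun x y hx hy => exactTwoProd_twoProdFMA₂ hp1 hfl (show emin ≤ e₀ + e₀ + e₀ by omega) hx hy)
    ha₁ ha₂ ha₃ hb₁ hb₂ hb₃ hc₁ hc₂ hc₃ hd₁ hd₂ hd₃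

/-! ## INCIRCLE -/

/-- INCIRCLE, filtered then exact: the stage-A filter with error-bound constant `K`; if it does
not accept, the last component of the exact expansion. -/
def incircleFiltered (tp : ℚ → ℚ → ℚ × ℚ) (fl : ℚ → ℚ) (K : ℚ)
    (a₁ a₂ b₁ b₂ c₁ c₂ d₁ d₂ : ℚ) : ℚ :=
  match incircleStageA fl K a₁ a₂ b₁ b₂ c₁ c₂ d₁ d₂ with
  | some A => A
  | none => lastComponent (incircleExact tp fl a₁ a₂ b₁ b₂ c₁ c₂ d₁ d₂)

/-- **INCIRCLE, FILTERED THEN EXACT, IS CORRECT**: with `K = iccerrboundA p = (10 + 96ε)ε`, `p ≥ 6`,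
any round-to-nearest `fl` with `RoundoffBelow 2`, an error-free two-product on
`F(p, ke₀) × F(p, e₀)` for `k = 1, 2, 3`, and coordinates in `F(p, e₀)` with `emin ≤ e₀`,
`emin + 2p ≤ 4e₀`, the returned float has exactly the sign of `incircleDet`. -/
theorem incircleFiltered_correct (hp : 6 ≤ p) (hfl : IsRoundNearest p emin fl)
    (hfl2 : RoundoffBelow 2 fl) {e₀ : ℤ} (he₀ : emin ≤ e₀)
    (h4 : emin + 2 * p ≤ e₀ + e₀ + e₀ + e₀) {tp : ℚ → ℚ → ℚ × ℚ}
    (htp : ∀ x y, IsFloat p e₀ x → IsFloat p e₀ y → ExactTwoProd p emin fl tp x y)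
    (htp' : ∀ x y, IsFloat p (e₀ + e₀) x → IsFloat p e₀ y → ExactTwoProd p emin fl tp x y)
    (htp'' : ∀ x y, IsFloat p (e₀ + e₀ + e₀) x → IsFloat p e₀ y → ExactTwoProd p emin fl tp x y)
    {a₁ a₂ b₁ b₂ c₁ c₂ d₁ d₂ : ℚ}
    (ha₁ : IsFloat p e₀ a₁) (ha₂ : IsFloat p e₀ a₂) (hb₁ : IsFloat p e₀ b₁)
    (hb₂ : IsFloat p e₀ b₂) (hc₁ : IsFloat p e₀ c₁) (hc₂ : IsFloat p e₀ c₂)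
    (hd₁ : IsFloat p e₀ d₁) (hd₂ : IsFloat p e₀ d₂) :
    (0 < incircleFiltered tp fl (iccerrboundA p) a₁ a₂ b₁ b₂ c₁ c₂ d₁ d₂ ↔
        0 < incircleDet a₁ a₂ b₁ b₂ c₁ c₂ d₁ d₂) ∧
      (incircleFiltered tp fl (iccerrboundA p) a₁ a₂ b₁ b₂ c₁ c₂ d₁ d₂ < 0 ↔
        incircleDet a₁ a₂ b₁ b₂ c₁ c₂ d₁ d₂ < 0) ∧
      (incircleFiltered tp fl (iccerrboundA p) a₁ a₂ b₁ b₂ c₁ c₂ d₁ d₂ = 0 ↔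
        incircleDet a₁ a₂ b₁ b₂ c₁ c₂ d₁ d₂ = 0) := by
  have key : (0 < incircleFiltered tp fl (iccerrboundA p) a₁ a₂ b₁ b₂ c₁ c₂ d₁ d₂ ↔
        0 < incircleDet a₁ a₂ b₁ b₂ c₁ c₂ d₁ d₂) ∧
      (incircleFiltered tp fl (iccerrboundA p) a₁ a₂ b₁ b₂ c₁ c₂ d₁ d₂ < 0 ↔
        incircleDet a₁ a₂ b₁ b₂ c₁ c₂ d₁ d₂ < 0) := by
    unfold incircleFiltered
    cases hA : incircleStageA fl (iccerrboundA p) a₁ a₂ b₁ b₂ c₁ c₂ d₁ d₂ with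
    | some A =>
      exact incircleStageA_correct hp hfl he₀ h4 ha₁ ha₂ hb₁ hb₂ hc₁ hc₂ hd₁ hd₂ hA
    | none =>
      obtain ⟨hD, s₁, s₂, -⟩ := incircleExact_sign (le_trans (by norm_num) hp) hfl hfl2
        (show emin ≤ e₀ + e₀ by omega) (show emin ≤ e₀ + e₀ + e₀ by omega)
        (show emin ≤ e₀ + e₀ + e₀ + e₀ by omega) htp htp' htp''
        ha₁ ha₂ hb₁ hb₂ hc₁ hc₂ hd₁ hd₂
      simp only [lastComponent_eq_getLast hD]
      exact ⟨s₁.symm, s₂.symm⟩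
  exact ⟨key.1, key.2, eq_zero_iff_of_sign_iff key.1 key.2⟩

/-- The IEEE instance: round-to-nearest-even and the FMA two-product. -/
def incircleFilteredRNE (p : ℕ) (emin : ℤ) (a₁ a₂ b₁ b₂ c₁ c₂ d₁ d₂ : ℚ) : ℚ :=
  incircleFiltered (twoProdFMA (roundTiesEven p emin)) (roundTiesEven p emin) (iccerrboundA p)
    a₁ a₂ b₁ b₂ c₁ c₂ d₁ d₂

/-- **INCIRCLE, FILTERED THEN EXACT, IS CORRECT ON AN IEEE MACHINE** (`p ≥ 6`, ties-to-even, FMA):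
for coordinates in `F(p, e₀)` with `emin ≤ e₀` and `emin + 2p ≤ 4e₀` (binary64: all eight
coordinates multiples of `2^−242`) the returned float has exactly the sign of `incircleDet`. -/
theorem incircleFilteredRNE_correct (hp : 6 ≤ p) {e₀ : ℤ} (he₀ : emin ≤ e₀)
    (h4 : emin + 2 * p ≤ e₀ + e₀ + e₀ + e₀) {a₁ a₂ b₁ b₂ c₁ c₂ d₁ d₂ : ℚ}
    (ha₁ : IsFloat p e₀ a₁) (ha₂ : IsFloat p e₀ a₂) (hb₁ : IsFloat p e₀ b₁)
    (hb₂ : IsFloat p e₀ b₂) (hc₁ : IsFloat p e₀ c₁) (hc₂ : IsFloat p e₀ c₂)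
    (hd₁ : IsFloat p e₀ d₁) (hd₂ : IsFloat p e₀ d₂) :
    (0 < incircleFilteredRNE p emin a₁ a₂ b₁ b₂ c₁ c₂ d₁ d₂ ↔
        0 < incircleDet a₁ a₂ b₁ b₂ c₁ c₂ d₁ d₂) ∧
      (incircleFilteredRNE p emin a₁ a₂ b₁ b₂ c₁ c₂ d₁ d₂ < 0 ↔
        incircleDet a₁ a₂ b₁ b₂ c₁ c₂ d₁ d₂ < 0) ∧
      (incircleFilteredRNE p emin a₁ a₂ b₁ b₂ c₁ c₂ d₁ d₂ = 0 ↔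
        incircleDet a₁ a₂ b₁ b₂ c₁ c₂ d₁ d₂ = 0) := by
  have hp1 : 1 ≤ p := le_trans (by norm_num) hp
  have hfl : IsRoundNearest p emin (roundTiesEven p emin) := isRoundNearest_roundTiesEven hp1
  have h2 : emin ≤ e₀ + e₀ := by omega
  exact incircleFiltered_correct hp hfl (roundoffBelow_two_roundTiesEven p emin) he₀ h4
    (fun x y hx hy => exactTwoProd_twoProdFMA₂ hp1 hfl h2 hx hy)
    (fun x y hx hy => exactTwoProd_twoProdFMA₂ hp1 hfl (show emin ≤ e₀ + e₀ + e₀ by omega) hx hy)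
    (fun x y hx hy =>
      exactTwoProd_twoProdFMA₂ hp1 hfl (show emin ≤ e₀ + e₀ + e₀ + e₀ by omega) hx hy)
    ha₁ ha₂ hb₁ hb₂ hc₁ hc₂ hd₁ hd₂

end Summit.Ventures.CertifiedArithmetic.Expansions
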